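import Literature.Probability.Percolation.MeanClusterSizeExponentFromFourFacts
import Literature.Probability.Percolation.FiveArmLowerBound
import Literature.Probability.Percolation.NearCriticalFourArmQuasiMult
import Literature.Probability.Percolation.PivotalLowerBoundFromSeparation
import HarnessLib

/-!
# `χ(p) = |p - 1/2|^{-43/18 + o(1)}` from the two arm exponents and near-critical four-arm separation (assembly, proofs only)

Topic `Literature/Probability/Percolation`; family `crit-perc`, statement **crit-perc.S16**, the
mean-cluster-size exponent `γ = 43/18`
(`Literature.Probability.Percolation.triMeanClusterSize_exponent`, `ArmExponents.lean`:
`log χ(p) / log |p - 1/2| → -43/18` as `p → 1/2`, `p ≠ 1/2`, where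
`χ(p) = E_p[|C(0)| ; |C(0)| < ∞] = triMeanClusterSize p`). PROOFS ONLY: no definition, no named
fact, no statement change.

This file shortens the list of unproved inputs of `γ = 43/18` in the tree once more, using two
results that have landed since `MeanClusterSizeExponentFromFourFacts.lean`:

* `Werner2009_fourArm_lowerBound_holds` (`FiveArmLowerBound.lean`) — the a priori four-arm lower
  bound `π̂_t(m, n) ≥ c (m/n)^{2-β}` below `L(p)` (Werner 2009, Lecture 6, §3, third estimate) is now
  a theorem (Reimer's inequality applied to the separation-free two-radii five-arm lower bound);
* `Werner2009_fourArm_quasiMult_of_separation` (`NearCriticalFourArmQuasiMult.lean`) and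
  `Werner2009_pivotal_lowerBound_of_separation` (`PivotalLowerBoundFromSeparation.lean`) — the
  quasi-multiplicativity of the four-arm probability below `L(p)` (Werner 2009, Cor. 6.2) and the
  interior pivotal lower bound (proof of Lemma 6.2) both follow from ONE explicit hypothesis, the
  comparability below `L(p)` of the well-separated alternating four-arm event `sepFourArm n N` with
  the four-arm event (Nolin 2008, Thm. 11 for `j = 4` [arXiv 0711.4948: Thm. 10]; Kesten 1987).

Consequently:

* `triMeanClusterSize_exponent_of_facts2` — `γ = 43/18` from FOUR named facts: `oneArm_exponent`,
  `fourArm_exponent` (the two SLE₆ exponents, Lawler–Schramm–Werner / Smirnov–Werner) and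
  `Werner2009_fourArm_quasiMult`, `Werner2009_pivotal_lowerBound`;
* `triMeanClusterSize_exponent_of_separation` — `γ = 43/18` from the two arm exponents and the
  near-critical four-arm separation hypothesis alone (same hypothesis, verbatim, as in
  `Werner2009_fourArm_quasiMult_of_separation`).

The discharge `triMeanClusterSize_exponent_holds` is `triMeanClusterSize_exponent_of_facts2` applied
to `oneArm_exponent_holds`, `fourArm_exponent_holds`, `Werner2009_fourArm_quasiMult_holds`,
`Werner2009_pivotal_lowerBound_holds` once these land (none is in the tree yet), equivalently
`triMeanClusterSize_exponent_of_separation` applied to the two exponents and a proof of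
near-critical four-arm separation.

Sources: S. Smirnov, W. Werner, *Critical exponents for two-dimensional percolation*, Math. Res.
Lett. 8 (2001), §2, Thm. 1 (ii) (`χ(p) = |p - 1/2|^{-43/18 + o(1)}`, attributed to Kesten's scaling
relations) [SmirnovWernerMRL2001, arXiv:math/0109120]; H. Kesten, *Scaling relations for
2D-percolation*, Comm. Math. Phys. 109 (1987), Thm. 2 and (4.5) [KestenScalingCMP1987]; P. Nolin,
*Near-critical percolation in two dimensions*, EJP 13 (2008), §4.3 Thm. 11, §6.1 Thm. 27, §7.3
Prop. 34, §7.5 Prop. 43 (arXiv 0711.4948: Thm. 10, Thm. 26, Prop. 32; Prop. 43 is the arXiv number)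
[Nolin2008]; W. Werner, *Lectures on two-dimensional critical percolation*, IAS/Park City Math.
Ser. 16 (2009), Lecture 6, §3–§5, Prop. 6.1, Cor. 6.2, Lemma 6.2 [WernerPCMI2009].

Tree: `triMeanClusterSize_exponent_of_facts3` (`MeanClusterSizeExponentFromFourFacts.lean`),
`Werner2009_fourArm_lowerBound_holds` (`FiveArmLowerBound.lean`),
`Werner2009_fourArm_quasiMult_of_separation` (`NearCriticalFourArmQuasiMult.lean`),
`Werner2009_pivotal_lowerBound_of_separation` (`PivotalLowerBoundFromSeparation.lean`); the events
`sepFourArm` (`ArmSeparationFourArm.lean`), `fourArmProbAt` (`WernerPivotalEstimates.lean`),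
`charLengthW` (`WernerCorrelationLength.lean`). Mathlib: nothing beyond the imports of these files.
-/

noncomputable section

open scoped unitInterval

namespace Literature.Probability.Percolation

open LatticeModels

/-- **`γ = 43/18` (Smirnov–Werner 2001, Thm. 1 (ii)) from four named facts of the tree**: the two
critical arm exponents `oneArm_exponent` (`5/48`), `fourArm_exponent` (`5/4`) and the two
near-critical inputs `Werner2009_fourArm_quasiMult` (Werner 2009, Cor. 6.2) and
`Werner2009_pivotal_lowerBound` (proof of Lemma 6.2, lower bound) imply
`triMeanClusterSize_exponent` — `triMeanClusterSize_exponent_of_facts3` with the a priori four-arm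
lower bound (§3, third estimate) supplied by the tree's theorem
`Werner2009_fourArm_lowerBound_holds`. The discharge `triMeanClusterSize_exponent_holds` is this
theorem applied to the four `_holds` once they land. [cite: SmirnovWernerMRL2001, §2, Thm. 1 (ii) (arXiv:math/0109120)] [cite: KestenScalingCMP1987, Thm. 2, (4.5) and the scaling relation for χ] [cite: Nolin2008, §7.5 Prop. 43 (arXiv 0711.4948 numbering), with §6.1 Thm. 27 and §7.3 Prop. 34 (EJP numbering)] [cite: WernerPCMI2009, Lecture 6, §3, Cor. 6.2, Lemma 6.2, §5] -/
theorem triMeanClusterSize_exponent_of_facts2 (h₁ : oneArm_exponent) (h₄ : fourArm_exponent)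
    (hQM : Werner2009_fourArm_quasiMult) (hP : Werner2009_pivotal_lowerBound) :
    triMeanClusterSize_exponent :=
  triMeanClusterSize_exponent_of_facts3 h₁ h₄ hQM Werner2009_fourArm_lowerBound_holds hP

/-- **`γ = 43/18` (Smirnov–Werner 2001, Thm. 1 (ii)) from the two arm exponents and near-critical
four-arm separation.** IF the one-arm and four-arm exponents hold (`oneArm_exponent`,
`fourArm_exponent`) and IF the well-separated four-arm event with alternating colours is comparable
to the four-arm event uniformly below Werner's length — for every small `ε` there are `n₀`, a right
neighbourhood `[1/2, 1/2 + δ)` of `1/2` and `c > 0` with `c · π̂_t(n, N) ≤ P_t(sepFourArm n N)` for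
`n₀ ≤ n`, `2n ≤ N`, and `N ≤ L(t, ε)` if `t > 1/2` (Nolin 2008, Thm. 11 for four alternating arms,
uniformly in `p` and `N ≤ L(p)`; Werner 2009, Prop. 6.1; Kesten 1987) — THEN
`log χ(p) / log |p - 1/2| → -43/18`: `triMeanClusterSize_exponent_of_facts2` with
quasi-multiplicativity from `Werner2009_fourArm_quasiMult_of_separation` and the interior pivotal
lower bound from `Werner2009_pivotal_lowerBound_of_separation`, both fed the same separation
hypothesis. [cite: SmirnovWernerMRL2001, §2, Thm. 1 (ii) (arXiv:math/0109120)] [cite: KestenScalingCMP1987, Thm. 2, (4.5) and the scaling relation for χ] [cite: Nolin2008, §4.3 Thm. 11 with Prop. 12, §7.5 Prop. 43 (arXiv 0711.4948: Thm. 10, Prop. 11; Prop. 43 is the arXiv number)] [cite: WernerPCMI2009, Lecture 6, Prop. 6.1, Cor. 6.2, Lemma 6.2, §5] -/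
theorem triMeanClusterSize_exponent_of_separation (h₁ : oneArm_exponent) (h₄ : fourArm_exponent)
    (hsep : ∃ ε₁ > (0 : ℝ), ∀ ⦃ε : ℝ⦄, 0 < ε → ε < ε₁ →
      ∃ n₀ : ℕ, ∃ δ > (0 : ℝ), ∃ c > (0 : ℝ),
        ∀ t : unitInterval, 1 / 2 ≤ (t : ℝ) → (t : ℝ) < 1 / 2 + δ →
          ∀ n N : ℕ, n₀ ≤ n → 2 * n ≤ N → (1 / 2 < (t : ℝ) → N ≤ charLengthW ε t) →
            c * fourArmProbAt t n N ≤ (triSitePercolation t).real (sepFourArm n N)) :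
    triMeanClusterSize_exponent :=
  triMeanClusterSize_exponent_of_facts2 h₁ h₄ (Werner2009_fourArm_quasiMult_of_separation hsep)
    (Werner2009_pivotal_lowerBound_of_separation hsep)

end Literature.Probability.Percolation
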